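import Mathlib
import HarnessLib
import Summits.HubbardSuperconductivity.HubbardSuperconductivity.Theorems.WeakCouplingBCSKlCertKlPtE1
import Summits.HubbardSuperconductivity.HubbardSuperconductivity.Theorems.ChiralWindowDefsPointRecord

/-!
# Route `WeakCouplingBCS` — crux `WcbcsBcsConstruction` (stmt-HubbardSuperconductivity-2010), stub `stub_klPointEnclosure` (Penc):
# rows E1 in the record's own fields (rfl-transport of `klPtB1g_normSq_mem`)

Companion of `WeakCouplingBCSKlCertKlPtE1.lean` (there the theorem is stated for the byte-identical copy `klPtB1g`, because this record module
had no olean on the verification farm when the chain was landed).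
`klTab klPtTab (klPtBox.blk D4Irrep.B1g).trial = klPtB1g` and `Nlo = 999/1000`, `Nhi = 1001/1000` hold by computation on the literals, so the
first two conjuncts of `(klPtBox.blk D4Irrep.B1g).EnclosureR klPtTab (-(21:ℝ)/25) D4Irrep.B1g` follow from `klPtB1g_normSq_mem`. [folklore]
-/

noncomputable section

-- the tree's namespace `Summit.<Summit>.<Problem>.Theorems` repeats the summit name by design (D-0017)
set_option linter.dupNamespace false

namespace Summit.HubbardSuperconductivity.HubbardSuperconductivity.Theorems.KlCertQuad

open Real Set MeasureTheory CwKLChiralWindow Literature.MathematicalPhysics.QuantumLattice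

/-- The `B1g` block's trial of the one-point record IS `klPtB1g` (same literal). [folklore] -/
theorem klPt_trial_eq_klPtB1g : klTab klPtTab (klPtBox.blk D4Irrep.B1g).trial = klPtB1g := rfl

/-- The record's `B1g` norm bounds are `999/1000` and `1001/1000` (kernel decision on the literals). [folklore] -/
theorem klPt_N_fields : (klPtBox.blk D4Irrep.B1g).Nlo = 999 / 1000 ∧ (klPtBox.blk D4Irrep.B1g).Nhi = 1001 / 1000 := by
  constructor <;> decide +kernel

/-- **Rows E1 of `stub_klPointEnclosure`, verbatim**: the first two conjuncts of
`(klPtBox.blk D4Irrep.B1g).EnclosureR klPtTab (-(21:ℝ)/25) D4Irrep.B1g`. [folklore] -/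
theorem klPt_enclosureR_E1 :
    ((klPtBox.blk D4Irrep.B1g).Nlo : ℝ) ≤
        ∫ k, (klPtBox.blk D4Irrep.B1g).trialFun klPtTab k ^ 2 ∂fermiCurveMeasure (squareDispersion 1 0) (-(21:ℝ) / 25) ∧
      ∫ k, (klPtBox.blk D4Irrep.B1g).trialFun klPtTab k ^ 2 ∂fermiCurveMeasure (squareDispersion 1 0) (-(21:ℝ) / 25) ≤
        ((klPtBox.blk D4Irrep.B1g).Nhi : ℝ) := by
  have htf : (klPtBox.blk D4Irrep.B1g).trialFun klPtTab = klPtB1g.toFun :=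
    congrArg KLTrig.toFun klPt_trial_eq_klPtB1g
  rw [htf, klPt_N_fields.1, klPt_N_fields.2]
  push_cast
  have h := klPtB1g_normSq_mem
  constructor <;> linarith [h.1, h.2]

end Summit.HubbardSuperconductivity.HubbardSuperconductivity.Theorems.KlCertQuad

end
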